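import Summits.ValiantsHypothesis.ValiantsHypothesis.Theorems.LacunarySymmetroidMatrixDescartesCensusFrame

/-!
# Route «KPlusLogSqLaw», crux `WeakLifting` (stmt-ValiantsHypothesis-19561) — the TRIDIAGONAL SECTOR SPLITS AT ABSENT LINKS
# (part 1 of 2: block factorisation of the pencil determinant, sub-additivity of the zero count, per-block Descartes bound)

HONEST FRAMING.  Helper lemmas (`--supports stmt-ValiantsHypothesis-19561 --as helper`) for the two WITNESS-PLAN stubs
`stub_tridiagonalSectorB` / `stub_tridiagonalSectorBDiag` registered in `Cruxes/WeakLifting/Lines/birth.lean` (re-cut v2): real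
symmetric lacunary pencils `∑ l, X^(d l) • S l` of format `(m, K)` whose coefficients `S l` are TRIDIAGONAL.  Nothing here proves either
stub in the window `c·log₂ m < K < m/2^c`; nothing bears on `WeakLifting`, on B (`KPlusLogSqLaw`), on `TropicalB` (stmt-19771), on
`MatrixDescartes` (stmt-18050) or on VP ≠ VNP.  Seat val-sym-lift-p4 (g3), 2026-08-26.  Part 2 (`…TridiagonalSectors`) draws the
sector consequences (coupling-free and bounded-coupling sub-sectors at all formats; the stub ⟺ its restriction to irreducible chains).

WHAT IS PROVED HERE («link `i`» = the entry pair `(i, i+1) / (i+1, i)`; a link is ABSENT when no class is present on it).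
* `det_pencil_split`, `card_roots_split`: if every coefficient vanishes on the rectangle «rows `≥ t` × columns `< t`» — for a symmetric
  tridiagonal family exactly «link `t − 1` absent», `cut_of_absentLink` — the determinant of the pencil is the product of the determinants
  of the pencils of its two diagonal blocks (sizes `t`, `m − t`; same exponents), and the number of distinct real zeros is SUB-ADDITIVE
  (`roots (p q) = roots p + roots q` for `p q ≠ 0`, the zero polynomial has no roots).
* blocks of symmetric / tridiagonal families are symmetric / tridiagonal (`symm_top/bot`, `tridiagonal_top/bot`); a block of size `t`
  has at most `2^(t + K)` distinct real zeros (`card_roots_le_two_pow`, from `Census.realRootLawAt_descartes`); `K = 0` or `m = 0` give none.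
* arithmetic of the sector bound: `m ≤ 2^(2⌊log₂ m⌋²)` (`self_le_two_pow_two_mul_log_sq`), monotonicity in the size (`sectorBound_mono`).
[folklore: block factorisation of tridiagonal determinants; Descartes' rule of signs]
-/

set_option linter.dupNamespace false
set_option autoImplicit false

namespace Summit.ValiantsHypothesis.ValiantsHypothesis.Theorems.KPlusLogSqLaw.TridiagonalSplitting

open Summit.ValiantsHypothesis.ValiantsHypothesis.Theorems.LacunarySymmetroidMatrixDescartes
open scoped BigOperators
open Polynomial

variable {m K : ℕ}

/-! ## 0. The pencil matrix, entrywise -/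

/-- entries of the pencil matrix `∑ l, X^(d l) • (S l).map C`. [folklore] -/
theorem pencil_apply (d : Fin K → ℕ) (S : Fin K → Matrix (Fin m) (Fin m) ℝ) (i j : Fin m) :
    (∑ l, ((X : ℝ[X]) ^ d l) • (S l).map C) i j = ∑ l, C (S l i j) * X ^ d l := by
  simp only [Matrix.sum_apply, Matrix.smul_apply, Matrix.map_apply, smul_eq_mul]
  exact Finset.sum_congr rfl fun l _ => mul_comm _ _

/-- an entry on which no class is present vanishes. [folklore] -/
theorem pencil_apply_eq_zero (d : Fin K → ℕ) (S : Fin K → Matrix (Fin m) (Fin m) ℝ) {i j : Fin m}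
    (h : ∀ l, S l i j = 0) : (∑ l, ((X : ℝ[X]) ^ d l) • (S l).map C) i j = 0 := by
  rw [pencil_apply]
  exact Finset.sum_eq_zero fun l _ => by rw [h l, map_zero, zero_mul]

/-! ## 1. Splitting at an absent link -/

/-- distinct real zeros are sub-additive under finite products (`roots (p * q) = roots p + roots q` for `p * q ≠ 0`; the zero
polynomial has no roots; the two-factor case is `RealTauRealTauRefined.card_roots_toFinset_mul_le`, inlined here to keep the routes'
import graphs apart). [folklore] -/
theorem card_roots_toFinset_prod_le {ι : Type*} (s : Finset ι) (f : ι → ℝ[X]) :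
    (∏ i ∈ s, f i).roots.toFinset.card ≤ ∑ i ∈ s, (f i).roots.toFinset.card := by
  classical
  induction s using Finset.induction_on with
  | empty => simp
  | insert a s ha ih =>
    rw [Finset.prod_insert ha, Finset.sum_insert ha]
    by_cases h : f a * ∏ i ∈ s, f i = 0
    · simp [h]
    · rw [Polynomial.roots_mul h, Multiset.toFinset_add]
      exact (Finset.card_union_le _ _).trans (Nat.add_le_add_left ih _)

/-- **BLOCK FACTORISATION.**  If every coefficient matrix vanishes on the rectangle «rows `≥ t` × columns `< t`», the determinant of the
pencil is the product of the determinants of the pencils of the two diagonal blocks (leading `t × t` block: indices `Fin.castLE`;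
trailing `(m − t) × (m − t)` block: indices `t + i`). [folklore] -/
theorem det_pencil_split (d : Fin K → ℕ) (S : Fin K → Matrix (Fin m) (Fin m) ℝ) {t : ℕ} (ht : t ≤ m)
    (hcut : ∀ l (i j : Fin m), (j : ℕ) < t → t ≤ (i : ℕ) → S l i j = 0) :
    Matrix.det (∑ l, ((X : ℝ[X]) ^ d l) • (S l).map C) =
      Matrix.det (∑ l, ((X : ℝ[X]) ^ d l) • ((S l).submatrix (Fin.castLE ht) (Fin.castLE ht)).map C) *
      Matrix.det (∑ l, ((X : ℝ[X]) ^ d l) •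
        ((S l).submatrix (fun i : Fin (m - t) => Fin.cast (Nat.add_sub_of_le ht) (Fin.natAdd t i))
          (fun i : Fin (m - t) => Fin.cast (Nat.add_sub_of_le ht) (Fin.natAdd t i))).map C) := by
  classical
  set M : Matrix (Fin m) (Fin m) ℝ[X] := ∑ l, ((X : ℝ[X]) ^ d l) • (S l).map C with hM
  -- reindex along `Fin t ⊕ Fin (m - t) ≃ Fin m`
  set e : Fin t ⊕ Fin (m - t) ≃ Fin m := finSumFinEquiv.trans (finCongr (Nat.add_sub_of_le ht)) with he
  have hel : ∀ i : Fin t, e (Sum.inl i) = Fin.castLE ht i := by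
    intro i
    apply Fin.ext
    simp [he]
  have her : ∀ i : Fin (m - t), e (Sum.inr i) = Fin.cast (Nat.add_sub_of_le ht) (Fin.natAdd t i) := by
    intro i
    apply Fin.ext
    simp [he]
  have hdet : M.det = (M.submatrix e e).det := (Matrix.det_submatrix_equiv_self e M).symm
  rw [hdet]
  have hblocks : M.submatrix e e =
      Matrix.fromBlocks (fun i j => M (e (Sum.inl i)) (e (Sum.inl j))) (fun i j => M (e (Sum.inl i)) (e (Sum.inr j)))
        0 (fun i j => M (e (Sum.inr i)) (e (Sum.inr j))) := by
    apply Matrix.ext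
    rintro (i | i) (j | j)
    · rfl
    · rfl
    · -- the vanishing rectangle
      rw [Matrix.submatrix_apply, Matrix.fromBlocks_apply₂₁, Matrix.zero_apply, hM]
      refine pencil_apply_eq_zero d S fun l => hcut l _ _ ?_ ?_
      · rw [hel]; simp
      · rw [her]; simp
    · rfl
  rw [hblocks, Matrix.det_fromBlocks_zero₂₁]
  congr 1
  · congr 1
    ext i j
    rw [hel, hel, hM, pencil_apply, pencil_apply]
    rfl
  · congr 1
    ext i j
    rw [her, her, hM, pencil_apply, pencil_apply]
    rfl

/-- **SPLITTING OF THE ZERO COUNT** at a vanishing rectangle: distinct real zeros of the pencil are at most those of the two blocks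
together. [folklore] -/
theorem card_roots_split (d : Fin K → ℕ) (S : Fin K → Matrix (Fin m) (Fin m) ℝ) {t : ℕ} (ht : t ≤ m)
    (hcut : ∀ l (i j : Fin m), (j : ℕ) < t → t ≤ (i : ℕ) → S l i j = 0) :
    (Matrix.det (∑ l, ((X : ℝ[X]) ^ d l) • (S l).map C)).roots.toFinset.card ≤
      (Matrix.det (∑ l, ((X : ℝ[X]) ^ d l) • ((S l).submatrix (Fin.castLE ht) (Fin.castLE ht)).map C)).roots.toFinset.card +
      (Matrix.det (∑ l, ((X : ℝ[X]) ^ d l) •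
        ((S l).submatrix (fun i : Fin (m - t) => Fin.cast (Nat.add_sub_of_le ht) (Fin.natAdd t i))
          (fun i : Fin (m - t) => Fin.cast (Nat.add_sub_of_le ht) (Fin.natAdd t i))).map C)).roots.toFinset.card := by
  classical
  rw [det_pencil_split d S ht hcut]
  set p := Matrix.det (∑ l, ((X : ℝ[X]) ^ d l) • ((S l).submatrix (Fin.castLE ht) (Fin.castLE ht)).map C)
  set q := Matrix.det (∑ l, ((X : ℝ[X]) ^ d l) •
        ((S l).submatrix (fun i : Fin (m - t) => Fin.cast (Nat.add_sub_of_le ht) (Fin.natAdd t i))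
          (fun i : Fin (m - t) => Fin.cast (Nat.add_sub_of_le ht) (Fin.natAdd t i))).map C)
  by_cases h : p * q = 0
  · simp [h]
  · rw [Polynomial.roots_mul h, Multiset.toFinset_add]
    exact Finset.card_union_le _ _

/-- for a TRIDIAGONAL family, an absent link `t − 1` (no class on the entry `(t, t−1)`) makes the whole rectangle «rows `≥ t` × columns
`< t`» vanish. [folklore] -/
theorem cut_of_absentLink (S : Fin K → Matrix (Fin m) (Fin m) ℝ)
    (htri : ∀ l (i j : Fin m), (i : ℕ) + 1 < j ∨ (j : ℕ) + 1 < i → S l i j = 0) {t : ℕ}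
    (hlink : ∀ l (i j : Fin m), (j : ℕ) + 1 = t → (i : ℕ) = t → S l i j = 0) :
    ∀ l (i j : Fin m), (j : ℕ) < t → t ≤ (i : ℕ) → S l i j = 0 := by
  intro l i j hj hi
  by_cases h : (j : ℕ) + 1 < i
  · exact htri l i j (Or.inr h)
  · exact hlink l i j (by omega) (by omega)

/-! ## 2. Inheritance: blocks of symmetric / tridiagonal families are symmetric / tridiagonal -/

/-- the leading block of a tridiagonal family is tridiagonal. [folklore] -/
theorem tridiagonal_top {S : Fin K → Matrix (Fin m) (Fin m) ℝ}
    (htri : ∀ l (i j : Fin m), (i : ℕ) + 1 < j ∨ (j : ℕ) + 1 < i → S l i j = 0) {t : ℕ} (ht : t ≤ m) :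
    ∀ l (i j : Fin t), (i : ℕ) + 1 < j ∨ (j : ℕ) + 1 < i →
      (S l).submatrix (Fin.castLE ht) (Fin.castLE ht) i j = 0 := by
  intro l i j h
  rw [Matrix.submatrix_apply]
  exact htri l _ _ (by simpa using h)

/-- the trailing block of a tridiagonal family is tridiagonal. [folklore] -/
theorem tridiagonal_bot {S : Fin K → Matrix (Fin m) (Fin m) ℝ}
    (htri : ∀ l (i j : Fin m), (i : ℕ) + 1 < j ∨ (j : ℕ) + 1 < i → S l i j = 0) {t : ℕ} (ht : t ≤ m) :
    ∀ l (i j : Fin (m - t)), (i : ℕ) + 1 < j ∨ (j : ℕ) + 1 < i →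
      (S l).submatrix (fun i : Fin (m - t) => Fin.cast (Nat.add_sub_of_le ht) (Fin.natAdd t i))
        (fun i : Fin (m - t) => Fin.cast (Nat.add_sub_of_le ht) (Fin.natAdd t i)) i j = 0 := by
  intro l i j h
  rw [Matrix.submatrix_apply]
  refine htri l _ _ ?_
  simp only [Fin.val_cast, Fin.val_natAdd]
  omega

/-! ## 3. Blocks: symmetry inheritance, the no-class case, the Descartes bound per block -/

/-- the leading block of a symmetric family is symmetric. [folklore] -/
theorem symm_top {S : Fin K → Matrix (Fin m) (Fin m) ℝ} (hS : ∀ l, (S l).IsSymm) {t : ℕ} (ht : t ≤ m) :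
    ∀ l, ((S l).submatrix (Fin.castLE ht) (Fin.castLE ht)).IsSymm :=
  fun l => (hS l).submatrix _

/-- the trailing block of a symmetric family is symmetric. [folklore] -/
theorem symm_bot {S : Fin K → Matrix (Fin m) (Fin m) ℝ} (hS : ∀ l, (S l).IsSymm) {t : ℕ} (ht : t ≤ m) :
    ∀ l, ((S l).submatrix (fun i : Fin (m - t) => Fin.cast (Nat.add_sub_of_le ht) (Fin.natAdd t i))
      (fun i : Fin (m - t) => Fin.cast (Nat.add_sub_of_le ht) (Fin.natAdd t i))).IsSymm :=
  fun l => (hS l).submatrix _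

/-- with no class at all (`K = 0`) the pencil is the zero matrix (or empty): no real zero is counted. [folklore] -/
theorem card_roots_eq_zero_of_noClass (hK : K = 0) (d : Fin K → ℕ) (S : Fin K → Matrix (Fin m) (Fin m) ℝ) :
    (Matrix.det (∑ l, ((X : ℝ[X]) ^ d l) • (S l).map C)).roots.toFinset.card = 0 := by
  subst hK
  have h0 : (∑ l : Fin 0, ((X : ℝ[X]) ^ d l) • (S l).map C) = 0 := by simp
  rw [h0]
  rcases Nat.eq_zero_or_pos m with hm | hm
  · subst hm
    simp [Matrix.det_isEmpty]
  · haveI : Nonempty (Fin m) := ⟨⟨0, hm⟩⟩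
    simp [Matrix.det_zero]

/-- Descartes per block, rounded up: a symmetric family of size `t` has at most `2^(t + K)` distinct real zeros
(`Census.realRootLawAt_descartes`: `2·C(t+K−1, t) − 1 ≤ 2^(t+K)`). [folklore] -/
theorem card_roots_le_two_pow (d : Fin K → ℕ) {t : ℕ} (S : Fin K → Matrix (Fin t) (Fin t) ℝ) (hS : ∀ l, (S l).IsSymm) :
    (Matrix.det (∑ l, ((X : ℝ[X]) ^ d l) • (S l).map C)).roots.toFinset.card ≤ 2 ^ (t + K) := by
  rcases Nat.eq_zero_or_pos K with hK | hK
  · rw [card_roots_eq_zero_of_noClass hK]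
    exact Nat.zero_le _
  · refine (Census.realRootLawAt_descartes t K hK d S hS).trans ?_
    have h1 : Nat.choose (t + K - 1) t ≤ 2 ^ (t + K - 1) := Nat.choose_le_two_pow _ _
    have h2 : 2 ^ (t + K) = 2 * 2 ^ (t + K - 1) := by
      rw [← pow_succ']
      congr 1
      omega
    omega

/-- an empty pencil (`m = 0`) has determinant `1`: no real zero. [folklore] -/
theorem card_roots_eq_zero_of_size_zero (hm : m = 0) (d : Fin K → ℕ) (S : Fin K → Matrix (Fin m) (Fin m) ℝ) :
    (Matrix.det (∑ l, ((X : ℝ[X]) ^ d l) • (S l).map C)).roots.toFinset.card = 0 := by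
  subst hm
  simp [Matrix.det_isEmpty]

/-! ## 4. Arithmetic of the sector bound -/

/-- `m ≤ 2^(2 ⌊log₂ m⌋²)` — the size of a pencil is absorbed by the `log₂² m` term of the sector bound. [folklore] -/
theorem self_le_two_pow_two_mul_log_sq (m : ℕ) : m ≤ 2 ^ (2 * Nat.log 2 m ^ 2) := by
  rcases Nat.lt_or_ge m 2 with hm | hm
  · interval_cases m <;> simp
  · have hL : 1 ≤ Nat.log 2 m := Nat.log_pos one_lt_two hm
    have hlt : m < 2 ^ (Nat.log 2 m + 1) := Nat.lt_pow_succ_log_self one_lt_two m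
    have hexp : Nat.log 2 m + 1 ≤ 2 * Nat.log 2 m ^ 2 := by nlinarith
    exact hlt.le.trans (Nat.pow_le_pow_right two_pos hexp)

/-- the sector bound is monotone in the size. [folklore] -/
theorem sectorBound_mono (C₀ K : ℕ) {a b : ℕ} (h : a ≤ b) :
    2 ^ (C₀ * (K + Nat.log 2 a ^ 2)) ≤ 2 ^ (C₀ * (K + Nat.log 2 b ^ 2)) :=
  Nat.pow_le_pow_right two_pos (Nat.mul_le_mul_left _ (Nat.add_le_add_left
    (Nat.pow_le_pow_left (Nat.log_mono_right h) 2) _))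


end Summit.ValiantsHypothesis.ValiantsHypothesis.Theorems.KPlusLogSqLaw.TridiagonalSplitting
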